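import Summits.KontsevichZagierPeriods.KontsevichZagierPeriods.Theses.HurwitzMicroSectors
import Literature.NumberTheory.Transcendental.BoxIntegralLTwoChiThree
import HarnessLib

/-!
# `BoxIntegralLTwoChiThree` (route HurwitzMicroSectors, item stmt-KontsevichZagierPeriods-3876)

The support item asks for integrability of `1/(1 + x₀x₁ + (x₀x₁)²)` on the open unit box of
`Fin 2 → ℝ` together with the evaluation
`∫_{(0,1)²} dx₀dx₁/(1 + x₀x₁ + (x₀x₁)²) = Σ_{n≥0} (1/(3n+1)² − 1/(3n+2)²)` (`= L(2,χ₋₃)`,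
Calegari–Dimitrov–Tang, arXiv:2408.15403, Thm. 1, p. 3).

This is, verbatim, the tree theorem
`Literature.NumberTheory.Transcendental.box_integral_L_two_chi_three`
(`Literature/NumberTheory/Transcendental/BoxIntegralLTwoChiThree.lean`), which we simply invoke.
-/

namespace Summit.KontsevichZagierPeriods.Theorems

open Literature.NumberTheory.Transcendental

/-- **Item stmt-KontsevichZagierPeriods-3876** (`BoxIntegralLTwoChiThree`): the kernel
`1/(1 + x₀x₁ + (x₀x₁)²)` is integrable on the open unit box `{x : Fin 2 → ℝ | ∀ i, x i ∈ (0,1)}` and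
`∫ = Σ_{n≥0} (1/(3n+1)² − 1/(3n+2)²)`; immediate from the Literature theorem
`box_integral_L_two_chi_three` [cite: CalegariDimitrovTang2024, Thm. 1 (p. 3)]. -/
theorem boxIntegralLTwoChiThree_proof :
    Summit.KontsevichZagierPeriods.KontsevichZagierPeriods.Theses.HurwitzMicroSectors.BoxIntegralLTwoChiThree := by
  unfold Summit.KontsevichZagierPeriods.KontsevichZagierPeriods.Theses.HurwitzMicroSectors.BoxIntegralLTwoChiThree
  exact box_integral_L_two_chi_three

end Summit.KontsevichZagierPeriods.Theorems
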